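import Literature.RepresentationTheory.FiniteGroups.PermutationModuleRecognition
import Literature.RepresentationTheory.FiniteGroups.AdditiveInvariantFiniteModuleHerbrand
import HarnessLib

/-!
# Additive invariants of finite `p`-torsion `ℤ[G]`-modules, III: functions on a finite `G`-set with
# values in a group of order `p` ARE the permutation module `ℤ[X]/p`

Topic `RepresentationTheory/FiniteGroups`; namespace `Literature.RepresentationTheory.FiniteGroups`
(sub-namespace `StableLatticeReduction.Int`, continued).  THEOREMS ONLY (no definition, no named
fact, no `sorry`, no instance).  Companion of `PermutationModuleRecognition` (`#(ℤ[X]/p) = p ^ #X`);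
the binder pair `(ψ, hψ)` of `StableLatticeReductionInvariantInt` (ψ with strict-implicit instance
binders — the same Π-type), additivity on short exact sequences with FINITE middle term KILLED BY `p`.

Source (Milne, *Arithmetic Duality Theorems*, I §5, proof of Thm. 5.1, p. 70; Tate in Cassels–Fröhlich
VII §7.3 Cor. 7.4 (b) "`H²(G, J_L) ≃ ⨿_v (1/n_v)ℤ/ℤ`"): the Brauer-group term of Tate's computation
is read through the vector of local invariants, a `Gal(E/F₀)`-equivariant map into the FUNCTIONS on
the places of `E` above `S` with values in `(1/p)ℤ/ℤ`; the lane's target spells the same class as the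
permutation module `ℤ[places]/p` (`EquivariantSUnitReduction`).  This file identifies the two:
for a finite `G`-set `X` and ANY abelian group `T` of order `p` (any `Module ℤ T` instance), the
representation `(g • f)(x) = f(g⁻¹ • x)` on `X → T` has the same `ψ` as
`(Representation.ofMulAction ℤ G X).quotient (p • ⊤)` — via the `G`-isomorphism
`ℤ[X]/p ⥲ (X → T)`, `[f] ↦ (x ↦ f.coeff x • t₀)` for a generator `t₀` of `T`.

## What is formalised (`G` a group, `p` a prime)

* `exists_generator_of_natCard_eq_prime` — an abelian group of order `p` is `ℤ • t₀`, `p • t₀ = 0`;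
* **`additive_pi_eq_permutation_quotient`** — `ψ (X → T, f ↦ f ∘ g⁻¹) = ψ (ℤ[X]/p)`;
* `natCard_invariants_pi_eq` — the fixed functions are the functions on the orbit space:
  `#(X → T)^G = #T ^ #(X/G)`;
* **`additive_permutation_quotient_eq_add_trivial_of_embedding`** — the `hH2`-shaped PACKAGE: an
  injective `G`-map `θ : X ↪ (Xs → T)` of index `p` from a module with fewer fixed vectors gives
  `ψ (ℤ[Xs]/p) = ψ X + ψ (ℤ/p)` (codimension-one splitting of `AdditiveInvariantFiniteModuleHerbrand`
  + the identification above).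

Written for lane «TATE-EPC-TC» of cell `bsd-eis` (road memo = evidence #54 on
stmt-BirchSwinnertonDyer-19032; lane state #60), brick B8, the glue between the invariant-vector
route «(θ)» for `[H²(E_S)[p]]` and the codimension-one splitting `additive_eq_add_trivial_of_card_quotient′`.

## References
* J. S. Milne, *Arithmetic Duality Theorems*, 2nd ed. (2006), I §5, proof of Thm. 5.1 (p. 70). [MilneADT2006]
* J. W. S. Cassels, A. Fröhlich (eds.), *Algebraic Number Theory* (1967), Ch. VII (Tate) §7.3 Cor. 7.4 (b).
  [CasselsFrohlichANT1967]
* J.-P. Serre, *Linear Representations of Finite Groups*, GTM 42 (1977), §15.2. [SerreLinearRepresentations1977]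
-/

universe u

namespace Literature.RepresentationTheory.FiniteGroups

namespace StableLatticeReduction.Int

open Function LinearMap Submodule StableLatticeReduction
open scoped Pointwise

variable {A : Type*} [AddCommGroup A] {p : ℕ}

/-- An abelian group of prime order `p` is generated by any non-zero element, every element is
killed by `p`, and a non-zero element exists. [cite: SerreLinearRepresentations1977, §15.2] -/
theorem exists_generator_of_natCard_eq_prime [hp : Fact p.Prime] {T : Type u} [AddCommGroup T]
    [Finite T] (hT : Nat.card T = p) :
    ∃ t₀ : T, t₀ ≠ 0 ∧ (∀ t : T, ∃ n : ℤ, n • t₀ = t) ∧ ∀ t : T, p • t = 0 := by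
  haveI : Fact (Nat.card T).Prime := ⟨hT.symm ▸ hp.out⟩
  haveI : Nontrivial T := Finite.one_lt_card_iff_nontrivial.1 (hT.symm ▸ hp.out.one_lt)
  obtain ⟨t₀, ht₀⟩ := exists_ne (0 : T)
  refine ⟨t₀, ht₀, fun t => ?_, fun t => ?_⟩
  · have htop : AddSubgroup.zmultiples t₀ = ⊤ :=
      ((AddSubgroup.zmultiples t₀).eq_bot_or_eq_top_of_prime_card).resolve_left
        (fun h => ht₀ ((AddSubgroup.zmultiples_eq_bot).1 h))
    exact (AddSubgroup.mem_zmultiples_iff).1 (htop.symm ▸ AddSubgroup.mem_top t)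
  · rw [← hT]
    exact (addOrderOf_dvd_iff_nsmul_eq_zero).1 (addOrderOf_dvd_natCard t)

section Pi

variable {G : Type} [Group G]
variable (ψ : ∀ ⦃X : Type⦄ ⦃_ : AddCommGroup X⦄ ⦃_ : Module ℤ X⦄, Representation ℤ G X → A)
  (hψ : ∀ ⦃X Y Z : Type⦄ [AddCommGroup X] [Module ℤ X] [AddCommGroup Y] [Module ℤ Y]
    [AddCommGroup Z] [Module ℤ Z] (ρX : Representation ℤ G X) (ρY : Representation ℤ G Y)
    (ρZ : Representation ℤ G Z) (f : X →ₗ[ℤ] Y) (g : Y →ₗ[ℤ] Z),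
    (∀ s x, f (ρX s x) = ρY s (f x)) → (∀ s y, g (ρY s y) = ρZ s (g y)) →
    Injective f → Surjective g → LinearMap.range f = LinearMap.ker g → Finite Y →
    (∀ y : Y, (p : ℤ) • y = 0) → ψ ρY = ψ ρX + ψ ρZ)
include hψ

/-- **Functions on a finite `G`-set with values in a group of order `p` are the permutation module
`ℤ[X]/p`.**  For a finite `G`-set `X`, an abelian group `T` with `#T = p` (any `Module ℤ T`
structure) and the representation `τ` of `G` on `X → T` by `(τ g f)(x) = f (g⁻¹ • x)`:
`ψ τ = ψ (ℤ[X]/p)` (`Representation.ofMulAction ℤ G X` on `MonoidAlgebra ℤ X`, reduced mod `p • ⊤`).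
Proof: for a generator `t₀` of `T`, `[f] ↦ (x ↦ f.coeff x • t₀)` is a `G`-isomorphism
(equivariant on `single`s, kills `p • ⊤`, surjective, bijective by `#(ℤ[X]/p) = p ^ #X = #(X → T)`).
[cite: CasselsFrohlichANT1967, Ch. VII §7.3 Cor. 7.4 (b)] [cite: MilneADT2006, I §5, proof of Thm. 5.1 (p. 70)] -/
theorem additive_pi_eq_permutation_quotient [hp : Fact p.Prime] (X : Type) [Fintype X]
    [MulAction G X] {T : Type} [AddCommGroup T] [instT : Module ℤ T] [Finite T]
    (hT : Nat.card T = p) (τ : Representation ℤ G (X → T))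
    (hτ : ∀ (g : G) (f : X → T) (x : X), τ g f x = f (g⁻¹ • x)) :
    ψ τ = ψ ((Representation.ofMulAction ℤ G X).quotient ((p : ℤ) • ⊤)
      (smul_top_le_comap (Representation.ofMulAction ℤ G X) (p : ℤ))) := by
  cases Subsingleton.elim instT (AddCommGroup.toIntModule T)
  classical
  obtain ⟨good_sub, good_quot, hψ'⟩ := admissible ψ hψ
  obtain ⟨t₀, -, hgen, hpT⟩ := exists_generator_of_natCard_eq_prime (p := p) hT
  have hpT' : ∀ t : T, (p : ℤ) • t = 0 := fun t => (natCast_zsmul t p).trans (hpT t)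
  have goodτ : Finite (X → T) ∧ ∀ f : X → T, (p : ℤ) • f = 0 :=
    ⟨inferInstance, fun f => funext fun x => by rw [Pi.smul_apply, Pi.zero_apply, hpT']⟩
  -- the comparison map `ℤ[X] → (X → T)`, `f ↦ (x ↦ f.coeff x • t₀)`
  let Φ₀ : MonoidAlgebra ℤ X →ₗ[ℤ] (X → T) :=
    { toFun := fun f x => f.coeff x • t₀
      map_add' := fun f f' => funext fun x => by
        rw [Pi.add_apply, MonoidAlgebra.coeff_add, Finsupp.add_apply, add_smul]
      map_smul' := fun n f => funext fun x => by
        rw [RingHom.id_apply, Pi.smul_apply, MonoidAlgebra.coeff_smul, Finsupp.smul_apply,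
          smul_eq_mul, mul_smul] }
  have hΦ₀ : ∀ (f : MonoidAlgebra ℤ X) (x : X), Φ₀ f x = f.coeff x • t₀ := fun _ _ => rfl
  have hΦ₀single : ∀ (x y : X) (a : ℤ), Φ₀ (MonoidAlgebra.single x a) y =
      (if x = y then a else 0) • t₀ := fun x y a => by
    rw [hΦ₀, MonoidAlgebra.coeff_single, Finsupp.single_apply]
  have hΦ₀ρ : ∀ (g : G) (f : MonoidAlgebra ℤ X),
      Φ₀ (Representation.ofMulAction ℤ G X g f) = τ g (Φ₀ f) := by
    intro g f
    induction f using MonoidAlgebra.induction_linear with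
    | zero => rw [map_zero, map_zero, map_zero]
    | add f₁ f₂ h₁ h₂ => simp only [map_add, h₁, h₂]
    | single x a =>
      funext y
      rw [Representation.ofMulAction_single, hΦ₀single, hτ, hΦ₀single]
      congr 2
      exact propext (smul_eq_iff_eq_inv_smul g)
  have hΦ₀surj : Surjective Φ₀ := fun h => by
    choose n hn using fun x => hgen (h x)
    refine ⟨MonoidAlgebra.ofCoeff (Finsupp.equivFunOnFinite.symm n), funext fun x => ?_⟩
    rw [hΦ₀, MonoidAlgebra.coeff_ofCoeff, Finsupp.coe_equivFunOnFinite_symm, hn]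
  have hker : ((p : ℤ) • ⊤ : Submodule ℤ (MonoidAlgebra ℤ X)) ≤ LinearMap.ker Φ₀ := by
    intro f hf
    obtain ⟨f', -, rfl⟩ := (mem_smul_pointwise_iff_exists f _ ⊤).1 hf
    rw [LinearMap.mem_ker, map_smul, goodτ.2]
  let Φ : MonoidAlgebra ℤ X ⧸ ((p : ℤ) • ⊤ : Submodule ℤ (MonoidAlgebra ℤ X)) →ₗ[ℤ] (X → T) :=
    Submodule.liftQ _ Φ₀ hker
  have hΦmk : ∀ f, Φ (Submodule.Quotient.mk f) = Φ₀ f := fun _ => rfl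
  have hΦsurj : Surjective Φ := fun h => by
    obtain ⟨f, hf⟩ := hΦ₀surj h
    exact ⟨Submodule.Quotient.mk f, by rw [hΦmk, hf]⟩
  haveI : Finite (MonoidAlgebra ℤ X ⧸ ((p : ℤ) • ⊤ : Submodule ℤ (MonoidAlgebra ℤ X))) :=
    Nat.finite_of_card_ne_zero (by
      rw [natCard_monoidAlgebra_quotient_smul_top]; exact pow_ne_zero _ hp.out.ne_zero)
  have hΦbij : Function.Bijective Φ := hΦsurj.bijective_of_nat_card_le (by
    rw [Nat.card_fun, hT, natCard_monoidAlgebra_quotient_smul_top, Nat.card_eq_fintype_card])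
  let e := LinearEquiv.ofBijective Φ hΦbij
  have he : ∀ s c, e (((Representation.ofMulAction ℤ G X).quotient ((p : ℤ) • ⊤)
      (smul_top_le_comap (Representation.ofMulAction ℤ G X) (p : ℤ))) s c) = τ s (e c) :=
    fun s c => by
    obtain ⟨f, rfl⟩ := mkQ_surjective _ c
    change Φ (Submodule.Quotient.mk (Representation.ofMulAction ℤ G X s f)) =
      τ s (Φ (Submodule.Quotient.mk f))
    rw [hΦmk, hΦmk, hΦ₀ρ]
  exact (Admissible.additive_eq_of_linearEquiv ψ _ good_quot hψ' _ τ goodτ e he).symm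

end Pi

/-! ### Invariants of the function module: functions on the orbit space -/

/-- **The `G`-fixed functions `X → T` (action `(τ g f)(x) = f (g⁻¹ • x)`) are the functions on the
orbit space**, so `#(X → T)^G = #T ^ #(X/G)`.  (Lane use: the `hfix` count of
`additive_eq_add_trivial_of_card_quotient′` for `P = (placesAbove → T)`: `#P^Δ = p ^ #S_f(F₀)`.)
Any `Module ℤ T` instance. [cite: CasselsFrohlichANT1967, Ch. VII §7.3 Cor. 7.4 (b)]
[cite: MilneADT2006, I §5, proof of Thm. 5.1 (p. 70)] -/
theorem natCard_invariants_pi_eq {G : Type*} [Group G] (X : Type u) [MulAction G X] [Finite X]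
    {T : Type u} [AddCommGroup T] [Module ℤ T] [Finite T] (τ : Representation ℤ G (X → T))
    (hτ : ∀ (g : G) (f : X → T) (x : X), τ g f x = f (g⁻¹ • x)) :
    Nat.card τ.invariants = Nat.card T ^ Nat.card (MulAction.orbitRel.Quotient G X) := by
  classical
  -- a fixed function is constant on orbits
  have hconst : ∀ f : τ.invariants, ∀ x y : X, MulAction.orbitRel G X x y →
      (f : X → T) x = (f : X → T) y := by
    rintro f x y ⟨g, rfl⟩
    have h := congrFun ((Representation.mem_invariants τ (f : X → T)).1 f.2 g) (g • y)
    rw [hτ, inv_smul_smul] at h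
    exact h.symm
  let e : τ.invariants ≃ (MulAction.orbitRel.Quotient G X → T) :=
    { toFun := fun f q => Quotient.liftOn' q (f : X → T) (fun x y h => hconst f x y h)
      invFun := fun h => ⟨fun x => h (Quotient.mk'' x), (Representation.mem_invariants τ _).2 fun g =>
        funext fun x => by
          rw [hτ]
          exact congrArg h (Quotient.sound' ⟨g⁻¹, rfl⟩)⟩
      left_inv := fun f => Subtype.ext (funext fun x => rfl)
      right_inv := fun h => funext fun q => Quotient.inductionOn' q fun x => rfl }
  rw [Nat.card_congr e, Nat.card_fun]

/-! ### The `hH2`-shaped package: an equivariant embedding of index `p` into the functions -/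

section Package

variable {G : Type} [Group G]
variable (ψ : ∀ ⦃X : Type⦄ ⦃_ : AddCommGroup X⦄ ⦃_ : Module ℤ X⦄, Representation ℤ G X → A)
  (hψ : ∀ ⦃X Y Z : Type⦄ [AddCommGroup X] [Module ℤ X] [AddCommGroup Y] [Module ℤ Y]
    [AddCommGroup Z] [Module ℤ Z] (ρX : Representation ℤ G X) (ρY : Representation ℤ G Y)
    (ρZ : Representation ℤ G Z) (f : X →ₗ[ℤ] Y) (g : Y →ₗ[ℤ] Z),
    (∀ s x, f (ρX s x) = ρY s (f x)) → (∀ s y, g (ρY s y) = ρZ s (g y)) →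
    Injective f → Surjective g → LinearMap.range f = LinearMap.ker g → Finite Y →
    (∀ y : Y, (p : ℤ) • y = 0) → ψ ρY = ψ ρX + ψ ρZ)
include hψ

/-- **The Brauer term of Tate's computation, packaged.**  Let `Xs` be a finite `G`-set, `T` an abelian
group of order `p`, `τ` the representation `(τ g f)(x) = f (g⁻¹ • x)` on `Xs → T`, and
`θ : X ↪ (Xs → T)` an injective `G`-map from a finite `ℤ[G]`-module `X` (any `Module ℤ` instances)
of index `p` (`#X · p = p ^ #Xs`) such that `X` has FEWER fixed vectors than `Xs → T`
(`#X^G < #(Xs → T)^G`; the right-hand side is `p ^ #(Xs/G)` by `natCard_invariants_pi_eq`).  Then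
`ψ (ℤ[Xs]/p) = ψ X + ψ (ℤ/p)` — for the lane: `X = H²(E_S)[p]`, `θ` = the vector of local invariants,
`Xs` = the places of `E` above `S`, and the two counts are NSW (8.3.11) at `E` and at `F₀`; the
conclusion is the hypothesis `hH2` of the Euler-characteristic assembly, in the spelling of
`EquivariantSUnitReduction`.
[cite: MilneADT2006, I §5, proof of Thm. 5.1 (p. 70)] [cite: CasselsFrohlichANT1967, Ch. VII §7.3 Cor. 7.4 (b)] -/
theorem additive_permutation_quotient_eq_add_trivial_of_embedding [hp : Fact p.Prime]
    (Xs : Type) [Fintype Xs] [MulAction G Xs] {T : Type} [AddCommGroup T] [instT : Module ℤ T]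
    [Finite T] (hT : Nat.card T = p) (τ : Representation ℤ G (Xs → T))
    (hτ : ∀ (g : G) (f : Xs → T) (x : Xs), τ g f x = f (g⁻¹ • x))
    {X : Type} [AddCommGroup X] [instX : Module ℤ X] [Finite X] (ρX : Representation ℤ G X)
    (θ : X →ₗ[ℤ] (Xs → T)) (hθ : ∀ (g : G) (x : X), θ (ρX g x) = τ g (θ x)) (hinj : Injective θ)
    (hindex : Nat.card X * p = p ^ Fintype.card Xs)
    (hinv : Nat.card ρX.invariants < Nat.card τ.invariants) :
    ψ ((Representation.ofMulAction ℤ G Xs).quotient ((p : ℤ) • ⊤)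
        (smul_top_le_comap (Representation.ofMulAction ℤ G Xs) (p : ℤ))) =
      ψ ρX + ψ ((Representation.trivial ℤ G ℤ).quotient ((p : ℤ) • ⊤)
        (smul_top_le_comap (Representation.trivial ℤ G ℤ) (p : ℤ))) := by
  cases Subsingleton.elim instT (AddCommGroup.toIntModule T)
  cases Subsingleton.elim instX (AddCommGroup.toIntModule X)
  classical
  obtain ⟨good_sub, good_quot, hψ'⟩ := admissible ψ hψ
  obtain ⟨t₀, -, -, hpT⟩ := exists_generator_of_natCard_eq_prime (p := p) hT
  have hP : ∀ f : Xs → T, p • f = 0 := fun f => funext fun x => by rw [Pi.smul_apply, Pi.zero_apply, hpT]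
  -- the image of `θ`
  let Y : Submodule ℤ (Xs → T) := LinearMap.range θ
  have hY : ∀ s, Y ≤ Y.comap (τ s) := range_le_comap_of_comm ρX τ θ hθ
  let e : X ≃ₗ[ℤ] Y := LinearEquiv.ofInjective θ hinj
  have he : ∀ s x, e (ρX s x) = (τ.subrepresentation Y hY) s (e x) := fun s x =>
    Subtype.ext (hθ s x)
  have goodY : Finite Y ∧ ∀ y : Y, (p : ℤ) • y = 0 :=
    ⟨inferInstance, fun y => Subtype.ext ((natCast_zsmul (y : Xs → T) p).trans (hP y))⟩
  have hψY : ψ ρX = ψ (τ.subrepresentation Y hY) :=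
    Admissible.additive_eq_of_linearEquiv ψ _ good_quot hψ' ρX _ goodY e he
  -- index `p`
  have hcardY : Nat.card Y = Nat.card X := (Nat.card_congr e.toEquiv).symm
  have hcardP : Nat.card (Xs → T) = p ^ Fintype.card Xs := by
    rw [Nat.card_fun, hT, Nat.card_eq_fintype_card]
  have hcard : Nat.card ((Xs → T) ⧸ Y) = p := by
    have h := Submodule.card_eq_card_quotient_mul_card Y
    rw [hcardP, ← hindex, hcardY] at h
    -- `h : #X * p = #X * #(P/Y)`
    exact (Nat.eq_of_mul_eq_mul_left Nat.card_pos h).symm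
  -- a fixed function outside the image
  have hfix : ∃ f : Xs → T, (∀ s, τ s f = f) ∧ f ∉ Y := by
    by_contra hcon
    have hall : ∀ f : τ.invariants, ((f : Xs → T)) ∈ Y := fun f => by
      by_contra hf
      exact hcon ⟨f, (Representation.mem_invariants τ _).1 f.2, hf⟩
    -- `τ.invariants ↪ ρX.invariants` through `θ⁻¹`
    have hle : Nat.card τ.invariants ≤ Nat.card ρX.invariants := by
      refine Nat.card_le_card_of_injective (fun f => ⟨e.symm ⟨(f : Xs → T), hall f⟩, ?_⟩) ?_
      · refine (Representation.mem_invariants ρX _).2 fun s => hinj ?_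
        have h1 : θ (e.symm ⟨(f : Xs → T), hall f⟩) = f :=
          congrArg Subtype.val (e.apply_symm_apply ⟨(f : Xs → T), hall f⟩)
        rw [hθ, h1]
        exact (Representation.mem_invariants τ _).1 f.2 s
      · intro f₁ f₂ h
        have h' := congrArg (fun z : ρX.invariants => ((e (z : X) : Y) : Xs → T)) h
        simp only [LinearEquiv.apply_symm_apply] at h'
        exact Subtype.ext h'
    exact absurd hinv (not_lt.2 hle)
  -- assemble: S1 on `(Xs → T) ⊇ Y`, then identify the functions with `ℤ[Xs]/p`
  have hS1 := additive_eq_add_trivial_of_card_quotient' ψ hψ τ hP Y hY hcard hfix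
  rw [← additive_pi_eq_permutation_quotient ψ hψ Xs hT τ hτ, hS1, hψY]

end Package

end StableLatticeReduction.Int

end Literature.RepresentationTheory.FiniteGroups
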